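import Summits.QuantumFields.BalabanUV.T4Continuum.Support.B13AvgCorrPlaquetteSecond
import Summits.QuantumFields.BalabanUV.T4Continuum.Support.B13AvgCorrPlaquetteWindow
import Summits.QuantumFields.BalabanUV.T4Continuum.Support.SubstrateAvgTowerStructure
import Literature.MathematicalPhysics.QuantumFieldTheory.Balaban1983to89.B15PrelimIntegrations
import Literature.MathematicalPhysics.QuantumFieldTheory.Balaban1983to89.TorusHypercubicSymmetry

/-!
# B13AvgCorrKappaOneLetters — row NE5, J-avg-reg SECOND ORDER (T4-DAG §8 Q52 (2), σ road; memo `t4/T4-EST-NE5-JAVG-SECOND.md` (C1)∕(S5)),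
# σ-END PART 1: THE INSTANCE LETTERS OF THE σ CHAIN — commutator, translate instance, translation-invariance of the window, telescoped bond quotient,
# and σ-L2's plaquette VARIATION read on `GaugeField P 0 G`

Cell `pub-balaban`, unit `b2b-balaban-t4-ne5-formalise-leaf-09` (NE5 formalisation swarm LEAF PROVER 09, gen 20; σ-END CLAIM `HOME/CLAIMS.log` l.25204,
«GO — NOT MINE; THIS SHAPE» by the κ-END lineage l.25293).  Summits-side NEW WORK under the LEAN PLACEMENT RULE; [folklore] throughout; 0 `def`; no
`Prop`-valued fact minted; no citation tag.  Imports LANDED modules only.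

HONEST FRAMING: rung (B)+1 of the FINITE-VOLUME T⁴ programme — NOT infinite volume, NOT a mass gap, NOT the Clay problem, NOT a proof of NE5 (NOT PRINTED;
GAPS G-t4-U3-1).  [folklore] estimates on OUR objects (`expMeanLogSU`, `avgTower`, `corr`, `corrAcc`, `holAt`, `loopWord`, `GaugeField.translate`); nothing of
[Balaban1985Averaging] Props 5–10 ∕ [Balaban1985BackgroundPropagators] (3.35)–(3.36) ∕ [Balaban1987RG1] (0.4)–(0.7) is asserted, reproduced or certified —
the window letters (α, β, β₂) are DISPLAYED hypotheses, discharged by nobody here.  HONEST DEPENDENCY (cell line, verbatim): continuum YM on T⁴ ⇐ BetaPertH ∧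
nine spine estimates (0/9 proved); BetaPertH ⇐ (D1) ∧ (D4) ∧ CAP+tail; G-an2-4 gates asym, D1 and NE2/3/4.

WHAT (the items that σ-L1 ∕ σ-L3 display «for the σ-END holder» — `HOME/CLAIMS.log` l.25059 ∕ l.25154):
* §1 `dist1_commutator_le` — σ-L1's displayed `hcomm : dist1 (a·b·a⁻¹·b⁻¹) ≤ 2·dist1 a·dist1 b` for ANY unitary `dist1`-realising reading `ι`
  (κ-L2 `B13AvgCorrPlaquette.norm_commutator_le`); `norm_map_sub_map` (`‖ι a − ι b‖ = dist1 (a·b⁻¹)`).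
* §2 THE TRANSLATE INSTANCE: `avgTower_translate` (tree `T4Continuum.iter_translate` + `BlockAveraging.blockAvg_translate`), `corr_translate`,
  **`corr_avgTower_translate`** (`corr ℰ (U_i (V ∘ τ_{scaleTo (i+1) a})) c = corr ℰ (U_i V) (c + a)`), `loopHol_avgTower_translate`, `scale_zero_shift` ∕
  `scaleTo_zero_shift` (`scaleTo k e_ν = L^k • e_ν`), `translate_zero_shift`.
* §3 the three window letters are translation invariant (`hsize_translate`, `hlip_translate`, `hsec_translate` — `hsec` is the body of the substrate's
  W-28a `SecondOrderWindow P ι V β₂` verbatim) and **`dist1_translate_nsmul_quot_le`** (`dist1 (V(b + m e_ν)·V(b)⁻¹) ≤ m·β∕(L^K)²`, σ-L1's `ht`).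
* §4 **`norm_plaqHol_shift_sub_le`** — σ-L2's «THE PLAQUETTE OF A (α, β, β₂)-REGULAR LEVEL IS LIPSCHITZ AT SCALE ℓ⁻³» (`B13AvgCorrPlaquetteSecond`, which is
  stated on the NE2 transporter carriers) READ ON `GaugeField P 0 G` through `ι` with the window letters (σ-L2 §1's generic `norm_plaq_sub_plaq_le` +
  `ab_sub_dc_eq` and the eight corner letters): `‖ι V(∂(p + e_ρ)) − ι V(∂p)‖ ≤ (2β₂ + 4αβ)∕(L^K)³ + 2β(2β + 2α²)∕(L^K)⁴`; `dist1_plaqHol_translate_quot_le`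
  and the telescoped **`dist1_plaqHol_translate_nsmul_quot_le`** (= σ-L1's `hp₁` letter for the translate by `m` unit steps).
0 sorry; axioms ⊆ {propext, Classical.choice, Quot.sound}.
-/

noncomputable section

open scoped BigOperators Matrix Matrix.Norms.L2Operator

namespace Summit.QuantumFields.BalabanUV.T4Continuum.B13AvgCorrKappaOneLetters

open Literature.MathematicalPhysics.QuantumFieldTheory.Balaban1983to89
open Literature.MathematicalPhysics.QuantumFieldTheory.Balaban1983to89.T4Continuum (walk holAt loopWord walkEnd iter_translate)
open Literature.MathematicalPhysics.QuantumFieldTheory.Balaban1983to89.BlockAveraging (Idx off loopHol corr blockAvg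
  loopHol_translate blockAvg_translate)
open Summit.QuantumFields.BalabanUV.T4Continuum.SubstrateAvgTowerStructure (avgTower)

/-! ## §1 The commutator letter of σ-L1 for a unitary `dist1`-realising reading -/

section Comm

variable {G : Type*} [GaugeGroup G] {o : Type*} [Fintype o] [DecidableEq o] (ι : G →* Matrix o o ℂ)

/-- [folklore] **THE COMMUTATOR LETTER** (σ-L1's displayed `hcomm`): for any unitary reading `ι` with `‖ι g − 1‖ = dist1 g`,
`dist1 (a·b·a⁻¹·b⁻¹) ≤ 2·dist1 a·dist1 b` — `ι` of the group commutator minus one is `(ιa·ιb − ιb·ιa)` times a unitary, and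
`‖[ιa, ιb]‖ ≤ 2‖ιa − 1‖‖ιb − 1‖` (κ-L2 `B13AvgCorrPlaquette.norm_commutator_le`). -/
theorem dist1_commutator_le (hι : ∀ g, ι g ∈ Matrix.unitaryGroup o ℂ) (hdist : ∀ g, ‖ι g - 1‖ = dist1 g) (a b : G) :
    dist1 (a * b * a⁻¹ * b⁻¹) ≤ 2 * dist1 a * dist1 b := by
  rw [← hdist, ← hdist a, ← hdist b]
  have hu : ι a⁻¹ * ι b⁻¹ ∈ Matrix.unitaryGroup o ℂ := mul_mem (hι _) (hι _)
  have e : ι (a * b * a⁻¹ * b⁻¹) - 1 = (ι a * ι b - ι b * ι a) * (ι a⁻¹ * ι b⁻¹) := by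
    have h1 : ι b * ι a * (ι a⁻¹ * ι b⁻¹) = 1 := by
      rw [← map_mul, ← map_mul, ← map_mul, show b * a * (a⁻¹ * b⁻¹) = 1 by group, map_one]
    rw [map_mul, map_mul, map_mul, sub_mul, h1]
    noncomm_ring
  rw [e, CStarRing.norm_mul_mem_unitary _ hu, mul_assoc]
  exact B13AvgCorrPlaquette.norm_commutator_le _ _

/-- [folklore] two-field reading of a quotient: `‖ι a − ι b‖ = dist1 (a·b⁻¹)`. -/
theorem norm_map_sub_map (hι : ∀ g, ι g ∈ Matrix.unitaryGroup o ℂ) (hdist : ∀ g, ‖ι g - 1‖ = dist1 g) (a b : G) :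
    ‖ι a - ι b‖ = dist1 (a * b⁻¹) := by
  rw [← hdist]
  have e : ι a - ι b = (ι (a * b⁻¹) - 1) * ι b := by rw [sub_mul, one_mul, ← map_mul, inv_mul_cancel_right]
  rw [e, CStarRing.norm_mul_mem_unitary _ (hι b)]

end Comm

/-! ## §2 The translate instance: a block shift at level `i+1` is a finest translation of `V` -/

section Translate

variable {P : Params} {G : Type*} [GaugeGroup G] (ℰ : LoopAverage G)

/-- [folklore] the averaging tower intertwines translations across levels (tree `iter_translate` + `blockAvg_translate`):
`U_i(V ∘ τ_{scaleTo i b}) = U_i(V) ∘ τ_b`. -/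
theorem avgTower_translate (i : ℕ) (b : Site P i) (V : GaugeField P 0 G) :
    avgTower ℰ (V.translate (Site.scaleTo i b)) i = (avgTower ℰ V i).translate b :=
  iter_translate (fun j => (blockAvg ℰ : Averaging P j G)) (fun _ a U => blockAvg_translate ℰ a U) i b V

/-- [folklore] the correction factor of a translated field is the correction factor at the translated block (tree `loopHol_translate`). -/
theorem corr_translate {j : ℕ} (a : Site P (j + 1)) (U : GaugeField P j G) (c : PBond P (j + 1)) :
    corr ℰ (U.translate (Site.scale a)) c = corr ℰ U (c.translate a) := by
  have hl : loopHol (U.translate (Site.scale a)) c = loopHol U (c.translate a) := funext (loopHol_translate a U c)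
  unfold corr BlockAveraging.Small
  rw [hl]

/-- [folklore] **THE BLOCK SHIFT AS A FINEST TRANSLATION**: `corr ℰ (U_i V) (c + a) = corr ℰ (U_i (V ∘ τ_{scaleTo (i+1) a})) c`. -/
theorem corr_avgTower_translate (i : ℕ) (a : Site P (i + 1)) (V : GaugeField P 0 G) (c : PBond P (i + 1)) :
    corr ℰ (avgTower ℰ (V.translate (Site.scaleTo (i + 1) a)) i) c = corr ℰ (avgTower ℰ V i) (c.translate a) := by
  rw [Site.scaleTo_succ, avgTower_translate, corr_translate]

/-- [folklore] the same for the loop variables of (0.4). -/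
theorem loopHol_avgTower_translate (i : ℕ) (a : Site P (i + 1)) (V : GaugeField P 0 G) (c : PBond P (i + 1)) (r : Idx P) :
    loopHol (avgTower ℰ (V.translate (Site.scaleTo (i + 1) a)) i) c r = loopHol (avgTower ℰ V i) (c.translate a) r := by
  rw [Site.scaleTo_succ, avgTower_translate, loopHol_translate]

/-- [folklore] `scale e_ν = L • e_ν` one level down. -/
theorem scale_zero_shift {j : ℕ} (ν : Fin P.d) :
    Site.scale ((0 : Site P (j + 1)).shift ν) = P.L • (0 : Site P j).shift ν := by
  funext κ
  show Site.scaleCoord P j (((0 : Site P (j + 1)).shift ν) κ) = P.L • (((0 : Site P j).shift ν) κ)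
  by_cases h : κ = ν
  · have h1 : ((0 : Site P (j + 1)).shift ν) κ = 1 := by rw [Site.shift_apply, if_pos h, Site.zero_apply, zero_add]
    have h2 : ((0 : Site P j).shift ν) κ = 1 := by rw [Site.shift_apply, if_pos h, Site.zero_apply, zero_add]
    rw [h1, h2, Site.scaleCoord_one, nsmul_eq_mul, mul_one]
  · have h1 : ((0 : Site P (j + 1)).shift ν) κ = 0 := by rw [Site.shift_apply, if_neg h, Site.zero_apply]
    have h2 : ((0 : Site P j).shift ν) κ = 0 := by rw [Site.shift_apply, if_neg h, Site.zero_apply]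
    rw [h1, h2, map_zero, smul_zero]

/-- [folklore] `scaleTo k e_ν = L^k • e_ν` on the finest lattice. -/
theorem scaleTo_zero_shift : ∀ (k : ℕ) (ν : Fin P.d),
    Site.scaleTo k ((0 : Site P k).shift ν) = P.L ^ k • (0 : Site P 0).shift ν
  | 0, ν => by rw [Site.scaleTo_zero, pow_zero, one_nsmul]
  | k + 1, ν => by
    rw [Site.scaleTo_succ, scale_zero_shift, map_nsmul, scaleTo_zero_shift k ν, smul_smul, ← pow_succ']

/-- [folklore] translating a bond by the unit vector `e_ν` shifts its source. -/
theorem translate_zero_shift {j : ℕ} (b : PBond P j) (ν : Fin P.d) : b.translate ((0 : Site P j).shift ν) = ⟨b.src.shift ν, b.dir⟩ := by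
  cases b; simp only [PBond.translate, Site.add_zero_shift]

end Translate

/-! ## §3 The window letters are translation invariant; the telescoped bond quotient -/

section Window

variable {P : Params} {G : Type*} [GaugeGroup G] {o : Type*} [Fintype o] [DecidableEq o] (ι : G →* Matrix o o ℂ)

/-- [folklore] the size letter is translation invariant. -/
theorem hsize_translate (V : GaugeField P 0 G) {α : ℝ} (hsize : ∀ b : PBond P 0, (P.L : ℝ) ^ P.K * dist1 (V b) ≤ α)
    (t : Site P 0) : ∀ b : PBond P 0, (P.L : ℝ) ^ P.K * dist1 (V.translate t b) ≤ α :=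
  fun _ => hsize _

/-- [folklore] the Lipschitz letter is translation invariant. -/
theorem hlip_translate (V : GaugeField P 0 G) {β : ℝ}
    (hlip : ∀ (x : Site P 0) (ν μ : Fin P.d), (P.L : ℝ) ^ P.K * ‖ι (V ⟨x.shift μ, ν⟩) - ι (V ⟨x, ν⟩)‖ ≤ β / (P.L : ℝ) ^ P.K)
    (t : Site P 0) :
    ∀ (x : Site P 0) (ν μ : Fin P.d), (P.L : ℝ) ^ P.K * ‖ι (V.translate t ⟨x.shift μ, ν⟩) - ι (V.translate t ⟨x, ν⟩)‖ ≤ β / (P.L : ℝ) ^ P.K := by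
  intro x ν μ
  have h := hlip (x + t) ν μ
  rw [Site.shift_add] at h
  exact h

/-- [folklore] the second-difference letter ((3.36) SHAPE, displayed) is translation invariant. -/
theorem hsec_translate (V : GaugeField P 0 G) {β₂ : ℝ}
    (hsec : ∀ (x : Site P 0) (μ ν ρ : Fin P.d), (P.L : ℝ) ^ P.K *
      ‖ι (V ⟨(x.shift ν).shift ρ, μ⟩) - ι (V ⟨x.shift ν, μ⟩) - ι (V ⟨x.shift ρ, μ⟩) + ι (V ⟨x, μ⟩)‖ ≤ β₂ / ((P.L : ℝ) ^ P.K) ^ 2)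
    (t : Site P 0) :
    ∀ (x : Site P 0) (μ ν ρ : Fin P.d), (P.L : ℝ) ^ P.K *
      ‖ι (V.translate t ⟨(x.shift ν).shift ρ, μ⟩) - ι (V.translate t ⟨x.shift ν, μ⟩) - ι (V.translate t ⟨x.shift ρ, μ⟩)
        + ι (V.translate t ⟨x, μ⟩)‖ ≤ β₂ / ((P.L : ℝ) ^ P.K) ^ 2 := by
  intro x μ ν ρ
  have h := hsec (x + t) μ ν ρ
  rw [Site.shift_add, Site.shift_add, Site.shift_add] at h
  exact h

/-- [folklore] **THE TELESCOPED BOND QUOTIENT**: under the Lipschitz letter, translating by `m` unit steps `e_ν` moves every bond variable by at most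
`m·β∕L^{2K}` in `dist1`-quotient: `dist1 (V (b + m e_ν) · (V b)⁻¹) ≤ m·β∕(L^K)²`. -/
theorem dist1_translate_nsmul_quot_le (hι : ∀ g, ι g ∈ Matrix.unitaryGroup o ℂ) (hdist : ∀ g, ‖ι g - 1‖ = dist1 g)
    (V : GaugeField P 0 G) {β : ℝ}
    (hlip : ∀ (x : Site P 0) (ν μ : Fin P.d), (P.L : ℝ) ^ P.K * ‖ι (V ⟨x.shift μ, ν⟩) - ι (V ⟨x, ν⟩)‖ ≤ β / (P.L : ℝ) ^ P.K)
    (ν : Fin P.d) : ∀ (m : ℕ) (b : PBond P 0),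
      dist1 (V.translate (m • (0 : Site P 0).shift ν) b * (V b)⁻¹) ≤ m * (β / ((P.L : ℝ) ^ P.K) ^ 2)
  | 0, b => by
    rw [zero_nsmul, GaugeField.translate_zero, mul_inv_cancel, GaugeGroup.dist1_one, Nat.cast_zero, zero_mul]
  | m + 1, b => by
    have hL : (0 : ℝ) < (P.L : ℝ) ^ P.K := pow_pos (by exact_mod_cast P.L_pos) _
    have ih := dist1_translate_nsmul_quot_le hι hdist V hlip ν m b
    -- one more unit step: from `b + m e_ν` to `b + (m+1) e_ν`
    set b' : PBond P 0 := b.translate (m • (0 : Site P 0).shift ν) with hb'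
    have hstep : dist1 (V.translate ((m + 1) • (0 : Site P 0).shift ν) b * (V.translate (m • (0 : Site P 0).shift ν) b)⁻¹)
        ≤ β / ((P.L : ℝ) ^ P.K) ^ 2 := by
      have e1 : V.translate ((m + 1) • (0 : Site P 0).shift ν) b = V (b'.translate ((0 : Site P 0).shift ν)) := by
        rw [succ_nsmul, ← GaugeField.translate_translate, GaugeField.translate_apply, GaugeField.translate_apply]
      have e2 : V.translate (m • (0 : Site P 0).shift ν) b = V b' := rfl
      rw [e1, e2, translate_zero_shift, ← norm_map_sub_map ι hι hdist]
      have h := hlip b'.src b'.dir ν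
      rw [pow_two, ← div_div, le_div_iff₀ hL, mul_comm]
      exact h
    calc dist1 (V.translate ((m + 1) • (0 : Site P 0).shift ν) b * (V b)⁻¹)
        ≤ dist1 (V.translate ((m + 1) • (0 : Site P 0).shift ν) b * (V.translate (m • (0 : Site P 0).shift ν) b)⁻¹)
          + dist1 (V.translate (m • (0 : Site P 0).shift ν) b * (V b)⁻¹) := B15.PrelimIntegrations.dist1_fluct_le _ _ _
      _ ≤ β / ((P.L : ℝ) ^ P.K) ^ 2 + m * (β / ((P.L : ℝ) ^ P.K) ^ 2) := add_le_add hstep ih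
      _ = ((m + 1 : ℕ) : ℝ) * (β / ((P.L : ℝ) ^ P.K) ^ 2) := by push_cast; ring

end Window

/-! ## §4 The plaquette VARIATION letter in the window currency (σ-L2's matrix algebra on `GaugeField P 0 G` through `ι`) -/

section Plaquette

variable {P : Params} {G : Type*} [GaugeGroup G] {o : Type*} [Fintype o] [DecidableEq o] (ι : G →* Matrix o o ℂ)

/-- [folklore] unit steps commute: `(x + e_ρ) + e_μ = (x + e_μ) + e_ρ`. -/
theorem shift_shift_comm (x : Site P 0) (ρ μ : Fin P.d) : (x.shift ρ).shift μ = (x.shift μ).shift ρ := by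
  rw [← Site.add_zero_shift x ρ, Site.shift_add, Site.add_zero_shift]

/-- [folklore] **THE PLAQUETTE OF A WINDOW FIELD IS LIPSCHITZ AT SCALE `L^{−3K}`** (σ-L2 `B13AvgCorrPlaquetteSecond.norm_plaq_sub_plaq_le` read on
`GaugeField P 0 G` through a unitary `dist1`-realising `ι`): from the size letter `α`, the Lipschitz letter `β` and the DISPLAYED second-difference
letter `β₂` (the body of the substrate's `SecondOrderWindow P ι V β₂`, W-28a),
`‖ι (V ∂(p + e_ρ)) − ι (V ∂p)‖ ≤ (2β₂ + 4αβ)∕(L^K)³ + 2β(2β + 2α²)∕(L^K)⁴` for every positively oriented plaquette `p` and direction `ρ`. -/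
theorem norm_plaqHol_shift_sub_le (hι : ∀ g, ι g ∈ Matrix.unitaryGroup o ℂ) (hdist : ∀ g, ‖ι g - 1‖ = dist1 g)
    (V : GaugeField P 0 G) {α β β₂ : ℝ}
    (hsize : ∀ b : PBond P 0, (P.L : ℝ) ^ P.K * dist1 (V b) ≤ α)
    (hlip : ∀ (x : Site P 0) (ν μ : Fin P.d), (P.L : ℝ) ^ P.K * ‖ι (V ⟨x.shift μ, ν⟩) - ι (V ⟨x, ν⟩)‖ ≤ β / (P.L : ℝ) ^ P.K)
    (hsec : ∀ (x : Site P 0) (μ ν ρ : Fin P.d), (P.L : ℝ) ^ P.K *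
      ‖ι (V ⟨(x.shift ν).shift ρ, μ⟩) - ι (V ⟨x.shift ν, μ⟩) - ι (V ⟨x.shift ρ, μ⟩) + ι (V ⟨x, μ⟩)‖ ≤ β₂ / ((P.L : ℝ) ^ P.K) ^ 2)
    (p : Plaq P 0) (ρ : Fin P.d) :
    ‖ι (GaugeField.plaqHol V (p.translate ((0 : Site P 0).shift ρ))) - ι (GaugeField.plaqHol V p)‖
      ≤ (2 * β₂ + 4 * α * β) / ((P.L : ℝ) ^ P.K) ^ 3 + 2 * β * (2 * β + 2 * α ^ 2) / ((P.L : ℝ) ^ P.K) ^ 4 := by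
  obtain ⟨x, μ, ν, hμν⟩ := p
  set X : ℝ := (P.L : ℝ) ^ P.K with hX
  have hX0 : 0 < X := pow_pos (by exact_mod_cast P.L_pos) _
  -- the eight corners
  set a := ι (V ⟨x, μ⟩)
  set b := ι (V ⟨x.shift μ, ν⟩)
  set c := ι (V ⟨x.shift ν, μ⟩)
  set e := ι (V ⟨x, ν⟩)
  set a' := ι (V ⟨x.shift ρ, μ⟩)
  set b' := ι (V ⟨(x.shift ρ).shift μ, ν⟩)
  set c' := ι (V ⟨(x.shift ρ).shift ν, μ⟩)
  set e' := ι (V ⟨x.shift ρ, ν⟩)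
  have hplaq : ∀ (y : Site P 0), ι (GaugeField.plaqHol V ⟨y, μ, ν, hμν⟩)
      = ι (V ⟨y, μ⟩) * ι (V ⟨y.shift μ, ν⟩) * star (ι (V ⟨y.shift ν, μ⟩)) * star (ι (V ⟨y, ν⟩)) := fun y => by
    simp only [GaugeField.plaqHol, map_mul, B13AvgCorrPlaquetteWindow.map_inv_eq_star ι hι]
  have hp' : GaugeField.plaqHol V (Plaq.translate ((0 : Site P 0).shift ρ) ⟨x, μ, ν, hμν⟩) = GaugeField.plaqHol V ⟨x.shift ρ, μ, ν, hμν⟩ := by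
    simp only [Plaq.translate, Site.add_zero_shift]
  rw [hp', hplaq, hplaq]
  -- letters: sizes
  have hsz : ∀ bd : PBond P 0, ‖ι (V bd) - 1‖ ≤ α / X := fun bd => by
    rw [hdist, le_div_iff₀ hX0, mul_comm]; exact hsize bd
  -- letters: first differences `‖ι V⟨y + e_κ, δ⟩ − ι V⟨y, δ⟩‖ ≤ β∕X²`
  have hl : ∀ (y : Site P 0) (δ κ : Fin P.d), ‖ι (V ⟨y.shift κ, δ⟩) - ι (V ⟨y, δ⟩)‖ ≤ β / X ^ 2 := fun y δ κ => by
    have h := hlip y δ κ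
    rw [pow_two, ← div_div, le_div_iff₀ hX0, mul_comm]; exact h
  -- letters: second differences `≤ β₂∕X³`
  have hs2 : ∀ (y : Site P 0) (δ κ₁ κ₂ : Fin P.d),
      ‖ι (V ⟨(y.shift κ₁).shift κ₂, δ⟩) - ι (V ⟨y.shift κ₁, δ⟩) - ι (V ⟨y.shift κ₂, δ⟩) + ι (V ⟨y, δ⟩)‖ ≤ β₂ / X ^ 3 := fun y δ κ₁ κ₂ => by
    have h := hsec y δ κ₁ κ₂
    rw [pow_succ, ← div_div, le_div_iff₀ hX0, mul_comm]; exact h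
  have hα : 0 ≤ α := le_trans (mul_nonneg hX0.le (GaugeGroup.dist1_nonneg _)) (hsize ⟨x, μ⟩)
  have hβ : 0 ≤ β := by
    have h := hl x μ ν; have h0 : (0 : ℝ) ≤ β / X ^ 2 := (norm_nonneg _).trans h
    rw [le_div_iff₀ (by positivity), zero_mul] at h0; exact h0
  -- the four unitaries
  have hcU : c ∈ Matrix.unitaryGroup o ℂ := hι _
  have heU : e ∈ Matrix.unitaryGroup o ℂ := hι _
  have hc'U : c' ∈ Matrix.unitaryGroup o ℂ := hι _
  have he'U : e' ∈ Matrix.unitaryGroup o ℂ := hι _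
  -- corner letters
  have ha1 : ‖a - 1‖ ≤ α / X := hsz _
  have hb1 : ‖b - 1‖ ≤ α / X := hsz _
  have hc1 : ‖c - 1‖ ≤ α / X := hsz _
  have he1 : ‖e - 1‖ ≤ α / X := hsz _
  have hb'1 : ‖b' - 1‖ ≤ α / X := hsz _
  have hc'1 : ‖c' - 1‖ ≤ α / X := hsz _
  have haa : ‖a' - a‖ ≤ β / X ^ 2 := hl x μ ρ
  have hbb : ‖b' - b‖ ≤ β / X ^ 2 := by
    show ‖ι (V ⟨(x.shift ρ).shift μ, ν⟩) - ι (V ⟨x.shift μ, ν⟩)‖ ≤ _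
    rw [shift_shift_comm]; exact hl _ ν ρ
  have hcc : ‖c' - c‖ ≤ β / X ^ 2 := by
    show ‖ι (V ⟨(x.shift ρ).shift ν, μ⟩) - ι (V ⟨x.shift ν, μ⟩)‖ ≤ _
    rw [shift_shift_comm]; exact hl _ μ ρ
  have hee : ‖e' - e‖ ≤ β / X ^ 2 := hl x ν ρ
  -- the two second differences (curl terms)
  have hA : ‖(a' - c') - (a - c)‖ ≤ β₂ / X ^ 3 := by
    have h1 := hs2 x μ ρ ν
    have e1 : (a' - c') - (a - c) = -(ι (V ⟨(x.shift ρ).shift ν, μ⟩) - ι (V ⟨x.shift ρ, μ⟩) - ι (V ⟨x.shift ν, μ⟩) + ι (V ⟨x, μ⟩)) := by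
      show (ι (V ⟨x.shift ρ, μ⟩) - ι (V ⟨(x.shift ρ).shift ν, μ⟩)) - (ι (V ⟨x, μ⟩) - ι (V ⟨x.shift ν, μ⟩)) = _; abel
    rw [e1, norm_neg]; exact h1
  have hB : ‖(b' - e') - (b - e)‖ ≤ β₂ / X ^ 3 := by
    have h1 := hs2 x ν ρ μ
    have e1 : (b' - e') - (b - e) = ι (V ⟨(x.shift ρ).shift μ, ν⟩) - ι (V ⟨x.shift ρ, ν⟩) - ι (V ⟨x.shift μ, ν⟩) + ι (V ⟨x, ν⟩) := by
      show (ι (V ⟨(x.shift ρ).shift μ, ν⟩) - ι (V ⟨x.shift ρ, ν⟩)) - (ι (V ⟨x.shift μ, ν⟩) - ι (V ⟨x, ν⟩)) = _; abel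
    rw [e1]; exact h1
  -- `X := ab − ec` and its variation
  have hXn : ‖a * b - e * c‖ ≤ (2 * β + 2 * α ^ 2) / X ^ 2 := by
    rw [B13AvgCorrPlaquetteSecond.ab_sub_dc_eq]
    have hac : ‖a - c‖ ≤ β / X ^ 2 := by rw [norm_sub_rev]; exact hl x μ ν
    have hbe : ‖b - e‖ ≤ β / X ^ 2 := hl x ν μ
    calc ‖a - c + (b - e) + (a - 1) * (b - 1) - (e - 1) * (c - 1)‖
        ≤ ‖a - c‖ + ‖b - e‖ + ‖a - 1‖ * ‖b - 1‖ + ‖e - 1‖ * ‖c - 1‖ := by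
          refine (norm_sub_le _ _).trans (add_le_add ((norm_add₃_le).trans (add_le_add le_rfl (norm_mul_le _ _))) (norm_mul_le _ _))
      _ ≤ β / X ^ 2 + β / X ^ 2 + α / X * (α / X) + α / X * (α / X) := by
          gcongr
      _ = (2 * β + 2 * α ^ 2) / X ^ 2 := by field_simp; ring
  have hdX : ‖(a' * b' - e' * c') - (a * b - e * c)‖ ≤ (2 * β₂ + 4 * α * β) / X ^ 3 := by
    have e1 : (a' * b' - e' * c') - (a * b - e * c)
        = ((a' - c') - (a - c)) + ((b' - e') - (b - e)) + ((a' - a) * (b' - 1) + (a - 1) * (b' - b))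
          - ((e' - e) * (c' - 1) + (e - 1) * (c' - c)) := by noncomm_ring
    rw [e1]
    calc ‖((a' - c') - (a - c)) + ((b' - e') - (b - e)) + ((a' - a) * (b' - 1) + (a - 1) * (b' - b))
          - ((e' - e) * (c' - 1) + (e - 1) * (c' - c))‖
        ≤ ‖(a' - c') - (a - c)‖ + ‖(b' - e') - (b - e)‖ + (‖a' - a‖ * ‖b' - 1‖ + ‖a - 1‖ * ‖b' - b‖)
          + (‖e' - e‖ * ‖c' - 1‖ + ‖e - 1‖ * ‖c' - c‖) := by
          refine (norm_sub_le _ _).trans (add_le_add ((norm_add₃_le).trans (add_le_add le_rfl ?_)) ?_)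
          · exact (norm_add_le _ _).trans (add_le_add (norm_mul_le _ _) (norm_mul_le _ _))
          · exact (norm_add_le _ _).trans (add_le_add (norm_mul_le _ _) (norm_mul_le _ _))
      _ ≤ β₂ / X ^ 3 + β₂ / X ^ 3 + (β / X ^ 2 * (α / X) + α / X * (β / X ^ 2)) + (β / X ^ 2 * (α / X) + α / X * (β / X ^ 2)) := by
          gcongr
      _ = (2 * β₂ + 4 * α * β) / X ^ 3 := by field_simp; ring
  -- assemble with σ-L2's generic variation lemma
  have key := B13AvgCorrPlaquetteSecond.norm_plaq_sub_plaq_le a b a' b' hcU heU hc'U he'U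
  calc ‖a' * b' * star c' * star e' - a * b * star c * star e‖
      ≤ ‖(a' * b' - e' * c') - (a * b - e * c)‖ + ‖a * b - e * c‖ * (‖c' - c‖ + ‖e' - e‖) := key
    _ ≤ (2 * β₂ + 4 * α * β) / X ^ 3 + (2 * β + 2 * α ^ 2) / X ^ 2 * (β / X ^ 2 + β / X ^ 2) := by
        gcongr
    _ = (2 * β₂ + 4 * α * β) / X ^ 3 + 2 * β * (2 * β + 2 * α ^ 2) / X ^ 4 := by field_simp; ring

/-- [folklore] the same in the `dist1`-quotient currency of σ-L1 (`plaq_pair_diff_bound_of_plaqHol`'s `hp` binder), for the field translated by ONE unit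
step `e_ρ`: `dist1 (V′(∂p)·V(∂p)⁻¹) ≤ (2β₂ + 4αβ)∕(L^K)³ + 2β(2β + 2α²)∕(L^K)⁴`, `V′ = V ∘ τ_{e_ρ}`. -/
theorem dist1_plaqHol_translate_quot_le (hι : ∀ g, ι g ∈ Matrix.unitaryGroup o ℂ) (hdist : ∀ g, ‖ι g - 1‖ = dist1 g)
    (V : GaugeField P 0 G) {α β β₂ : ℝ}
    (hsize : ∀ b : PBond P 0, (P.L : ℝ) ^ P.K * dist1 (V b) ≤ α)
    (hlip : ∀ (x : Site P 0) (ν μ : Fin P.d), (P.L : ℝ) ^ P.K * ‖ι (V ⟨x.shift μ, ν⟩) - ι (V ⟨x, ν⟩)‖ ≤ β / (P.L : ℝ) ^ P.K)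
    (hsec : ∀ (x : Site P 0) (μ ν ρ : Fin P.d), (P.L : ℝ) ^ P.K *
      ‖ι (V ⟨(x.shift ν).shift ρ, μ⟩) - ι (V ⟨x.shift ν, μ⟩) - ι (V ⟨x.shift ρ, μ⟩) + ι (V ⟨x, μ⟩)‖ ≤ β₂ / ((P.L : ℝ) ^ P.K) ^ 2)
    (ρ : Fin P.d) (p : Plaq P 0) :
    dist1 (GaugeField.plaqHol (V.translate ((0 : Site P 0).shift ρ)) p * (GaugeField.plaqHol V p)⁻¹)
      ≤ (2 * β₂ + 4 * α * β) / ((P.L : ℝ) ^ P.K) ^ 3 + 2 * β * (2 * β + 2 * α ^ 2) / ((P.L : ℝ) ^ P.K) ^ 4 := by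
  rw [← norm_map_sub_map ι hι hdist, GaugeField.plaqHol_translate]
  exact norm_plaqHol_shift_sub_le ι hι hdist V hsize hlip hsec p ρ

/-- [folklore] **TELESCOPED OVER `m` UNIT STEPS** (the block shift of averaging step `i` is `m = L^{i+1}` finest steps): with the window letters
translation invariant (§3), `dist1 (V_m(∂p)·V(∂p)⁻¹) ≤ m·[(2β₂ + 4αβ)∕(L^K)³ + 2β(2β + 2α²)∕(L^K)⁴]`, `V_m = V ∘ τ_{m e_ρ}`. -/
theorem dist1_plaqHol_translate_nsmul_quot_le (hι : ∀ g, ι g ∈ Matrix.unitaryGroup o ℂ) (hdist : ∀ g, ‖ι g - 1‖ = dist1 g)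
    (V : GaugeField P 0 G) {α β β₂ : ℝ}
    (hsize : ∀ b : PBond P 0, (P.L : ℝ) ^ P.K * dist1 (V b) ≤ α)
    (hlip : ∀ (x : Site P 0) (ν μ : Fin P.d), (P.L : ℝ) ^ P.K * ‖ι (V ⟨x.shift μ, ν⟩) - ι (V ⟨x, ν⟩)‖ ≤ β / (P.L : ℝ) ^ P.K)
    (hsec : ∀ (x : Site P 0) (μ ν ρ : Fin P.d), (P.L : ℝ) ^ P.K *
      ‖ι (V ⟨(x.shift ν).shift ρ, μ⟩) - ι (V ⟨x.shift ν, μ⟩) - ι (V ⟨x.shift ρ, μ⟩) + ι (V ⟨x, μ⟩)‖ ≤ β₂ / ((P.L : ℝ) ^ P.K) ^ 2)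
    (ρ : Fin P.d) : ∀ (m : ℕ) (p : Plaq P 0),
      dist1 (GaugeField.plaqHol (V.translate (m • (0 : Site P 0).shift ρ)) p * (GaugeField.plaqHol V p)⁻¹)
        ≤ m * ((2 * β₂ + 4 * α * β) / ((P.L : ℝ) ^ P.K) ^ 3 + 2 * β * (2 * β + 2 * α ^ 2) / ((P.L : ℝ) ^ P.K) ^ 4)
  | 0, p => by
    rw [zero_nsmul, GaugeField.translate_zero, mul_inv_cancel, GaugeGroup.dist1_one, Nat.cast_zero, zero_mul]
  | m + 1, p => by
    have ih := dist1_plaqHol_translate_nsmul_quot_le hι hdist V hsize hlip hsec ρ m p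
    set W : GaugeField P 0 G := V.translate (m • (0 : Site P 0).shift ρ) with hW
    have hstep : dist1 (GaugeField.plaqHol (V.translate ((m + 1) • (0 : Site P 0).shift ρ)) p * (GaugeField.plaqHol W p)⁻¹)
        ≤ (2 * β₂ + 4 * α * β) / ((P.L : ℝ) ^ P.K) ^ 3 + 2 * β * (2 * β + 2 * α ^ 2) / ((P.L : ℝ) ^ P.K) ^ 4 := by
      have e1 : V.translate ((m + 1) • (0 : Site P 0).shift ρ) = W.translate ((0 : Site P 0).shift ρ) := by
        rw [succ_nsmul', ← GaugeField.translate_translate]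
      rw [e1]
      exact dist1_plaqHol_translate_quot_le ι hι hdist W (hsize_translate V hsize _) (hlip_translate ι V hlip _)
        (hsec_translate ι V hsec _) ρ p
    calc dist1 (GaugeField.plaqHol (V.translate ((m + 1) • (0 : Site P 0).shift ρ)) p * (GaugeField.plaqHol V p)⁻¹)
        ≤ dist1 (GaugeField.plaqHol (V.translate ((m + 1) • (0 : Site P 0).shift ρ)) p * (GaugeField.plaqHol W p)⁻¹)
          + dist1 (GaugeField.plaqHol W p * (GaugeField.plaqHol V p)⁻¹) := B15.PrelimIntegrations.dist1_fluct_le _ _ _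
      _ ≤ _ := add_le_add hstep ih
      _ = ((m + 1 : ℕ) : ℝ) * _ := by push_cast; ring

end Plaquette

end Summit.QuantumFields.BalabanUV.T4Continuum.B13AvgCorrKappaOneLetters

end
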